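import Summits.Ventures.HodgeRepro2.T5FinitePlaceCMDecomp
import Mathlib.NumberTheory.RamificationInertia.Galois

/-!
# The local-degree formula `e · f = [K_w : K⁺_v]` at the non-split places of a CM field
(cell pub-hodge-repro2, seat p3)

Tier-5 N2 support, §N2.9.2 of route/T5-N2-route-3.md («completions») at the finite places. Mathlib's fundamental
identity for the Galois extension `K / K⁺` (`Ideal.ncard_primesOver_mul_ramificationIdxIn_mul_inertiaDegIn`:
`#{w ∣ v} · e · f = |Gal(K/K⁺)| = 2`) gives `e · f = 2` at a place `v` with ONE prime above it, and file 122 gives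
`[K_w : K⁺_v] = 2` there: so **`e(w∣v) · f(w∣v) = [K_w : K⁺_v]`** — the local-degree formula — holds in kernel at
every non-split place (`ramificationIdx_mul_inertiaDeg_eq_finrank`), and `e · f = 2`, `e ∣ 2`, `f ∣ 2`
(`ramificationIdx_mul_inertiaDeg_eq_two`). At a split place (`θ` a `v`-adic square) the fundamental identity gives
`#{w ∣ v} · e · f = 2` with `#{w ∣ v} ≠ 1` (file 122), hence **exactly two primes above `v`, `e = f = 1`**
(`ncard_primesOver_eq_two_of_isSquare`, `ramificationIdx_eq_one_of_isSquare`, `inertiaDeg_eq_one_of_isSquare`), and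
`[K_w : K⁺_v] = 1 = e · f` there too — so the local-degree formula holds at EVERY finite place of `K⁺` once the
split/non-split status is known from `θ`; only the implication «two primes ⟹ `θ` a `v`-adic square» stays prose.
Mathlib + files 120–122 only. No display; no device. §8(d): uses an L-value-free non-vanishing device: NO.
-/

namespace Summit.Ventures.HodgeRepro2.T5FinitePlaceLocalDegree

open IsDedekindDomain IsDedekindDomain.HeightOneSpectrum NumberField NumberField.IsCMField Module
open scoped Summit.Ventures.HodgeRepro2.T5FinitePlaceLiesOver
open Summit.Ventures.HodgeRepro2.T5FinitePlaceCM Summit.Ventures.HodgeRepro2.T5FinitePlaceCMDecomp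

variable (K : Type*) [Field K] [NumberField K] [IsCMField K]
variable (v : HeightOneSpectrum (𝓞 (maximalRealSubfield K)))

/-- **Mathlib's fundamental identity on `K / K⁺`:** `#{w ∣ v} · (e · f) = 2`. -/
theorem ncard_primesOver_mul_eq_two :
    (v.asIdeal.primesOver (𝓞 K)).ncard *
      (v.asIdeal.ramificationIdxIn (𝓞 K) * v.asIdeal.inertiaDegIn (𝓞 K)) = 2 := by
  rw [Ideal.ncard_primesOver_mul_ramificationIdxIn_mul_inertiaDegIn v.asIdeal (𝓞 K)
    (K ≃ₐ[maximalRealSubfield K] K), IsGalois.card_aut_eq_finrank,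
    Algebra.IsQuadraticExtension.finrank_eq_two]

/-- `e · f = 2` when there is ONE prime above `v`. -/
theorem ramificationIdxIn_mul_inertiaDegIn_eq_two (h1 : (v.asIdeal.primesOver (𝓞 K)).ncard = 1) :
    v.asIdeal.ramificationIdxIn (𝓞 K) * v.asIdeal.inertiaDegIn (𝓞 K) = 2 := by
  have := ncard_primesOver_mul_eq_two K v
  rwa [h1, one_mul] at this

variable (w : HeightOneSpectrum (𝓞 K)) [w.asIdeal.LiesOver v.asIdeal]

/-- `e(w∣v) · f(w∣v) = 2` when there is ONE prime above `v`. -/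
theorem ramificationIdx_mul_inertiaDeg_eq_two (h1 : (v.asIdeal.primesOver (𝓞 K)).ncard = 1) :
    w.asIdeal.ramificationIdx (𝓞 (maximalRealSubfield K)) * w.asIdeal.inertiaDeg (𝓞 (maximalRealSubfield K)) = 2 := by
  rw [← Ideal.ramificationIdxIn_eq_ramificationIdx v.asIdeal w.asIdeal (K ≃ₐ[maximalRealSubfield K] K),
    ← Ideal.inertiaDegIn_eq_inertiaDeg v.asIdeal w.asIdeal (K ≃ₐ[maximalRealSubfield K] K)]
  exact ramificationIdxIn_mul_inertiaDegIn_eq_two K v h1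

variable {θ : maximalRealSubfield K} {y : K}
variable (hθ : algebraMap (maximalRealSubfield K) K θ = y ^ 2) (hy : complexConj K y ≠ y)

include hθ hy in
/-- **The local-degree formula at a non-split place:** `e(w∣v) · f(w∣v) = [K_w : K⁺_v]` when `v` has one prime above
it (both sides are `2`: Mathlib's fundamental identity and file 122). -/
theorem ramificationIdx_mul_inertiaDeg_eq_finrank (h1 : (v.asIdeal.primesOver (𝓞 K)).ncard = 1) :
    w.asIdeal.ramificationIdx (𝓞 (maximalRealSubfield K)) * w.asIdeal.inertiaDeg (𝓞 (maximalRealSubfield K)) =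
      finrank (v.adicCompletion (maximalRealSubfield K)) (w.adicCompletion K) := by
  rw [ramificationIdx_mul_inertiaDeg_eq_two K v w h1, finrank_eq_two_of_ncard_primesOver_eq_one K hθ hy v w h1]

include hθ hy w in
/-- **A `v`-adic square `θ` ⟹ exactly TWO primes above `v`** (the fundamental identity with `#{w ∣ v} ≠ 1`; `w` is
any prime above `v`). -/
theorem ncard_primesOver_eq_two_of_isSquare
    (hsq : IsSquare (algebraMap (maximalRealSubfield K) (v.adicCompletion (maximalRealSubfield K)) θ)) :
    (v.asIdeal.primesOver (𝓞 K)).ncard = 2 := by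
  have h := ncard_primesOver_mul_eq_two K v
  have hne := ncard_primesOver_ne_one_of_isSquare K hθ hy v w hsq
  have hef : v.asIdeal.ramificationIdxIn (𝓞 K) * v.asIdeal.inertiaDegIn (𝓞 K) ≠ 0 := by
    intro h0; rw [h0, mul_zero] at h; exact two_ne_zero h.symm
  have hn : (v.asIdeal.primesOver (𝓞 K)).ncard ∣ 2 := ⟨_, h.symm⟩
  rcases (Nat.dvd_prime Nat.prime_two).mp hn with h1 | h2
  · exact absurd h1 hne
  · exact h2

include hθ hy w in
/-- A `v`-adic square `θ` ⟹ `e · f = 1`. -/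
theorem ramificationIdxIn_mul_inertiaDegIn_eq_one_of_isSquare
    (hsq : IsSquare (algebraMap (maximalRealSubfield K) (v.adicCompletion (maximalRealSubfield K)) θ)) :
    v.asIdeal.ramificationIdxIn (𝓞 K) * v.asIdeal.inertiaDegIn (𝓞 K) = 1 := by
  have h := ncard_primesOver_mul_eq_two K v
  rw [ncard_primesOver_eq_two_of_isSquare K v w hθ hy hsq] at h
  omega

include hθ hy in
/-- A `v`-adic square `θ` ⟹ `v` is unramified in `K`: `e(w∣v) = 1`. -/
theorem ramificationIdx_eq_one_of_isSquare
    (hsq : IsSquare (algebraMap (maximalRealSubfield K) (v.adicCompletion (maximalRealSubfield K)) θ)) :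
    w.asIdeal.ramificationIdx (𝓞 (maximalRealSubfield K)) = 1 := by
  have h := ramificationIdxIn_mul_inertiaDegIn_eq_one_of_isSquare K v w hθ hy hsq
  rw [Ideal.ramificationIdxIn_eq_ramificationIdx v.asIdeal w.asIdeal (K ≃ₐ[maximalRealSubfield K] K),
    Ideal.inertiaDegIn_eq_inertiaDeg v.asIdeal w.asIdeal (K ≃ₐ[maximalRealSubfield K] K)] at h
  exact Nat.eq_one_of_mul_eq_one_right h

include hθ hy in
/-- A `v`-adic square `θ` ⟹ `f(w∣v) = 1`. -/
theorem inertiaDeg_eq_one_of_isSquare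
    (hsq : IsSquare (algebraMap (maximalRealSubfield K) (v.adicCompletion (maximalRealSubfield K)) θ)) :
    w.asIdeal.inertiaDeg (𝓞 (maximalRealSubfield K)) = 1 := by
  have h := ramificationIdxIn_mul_inertiaDegIn_eq_one_of_isSquare K v w hθ hy hsq
  rw [Ideal.ramificationIdxIn_eq_ramificationIdx v.asIdeal w.asIdeal (K ≃ₐ[maximalRealSubfield K] K),
    Ideal.inertiaDegIn_eq_inertiaDeg v.asIdeal w.asIdeal (K ≃ₐ[maximalRealSubfield K] K)] at h
  exact Nat.eq_one_of_mul_eq_one_left h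

include hθ hy in
/-- **The local-degree formula at a split place:** `e · f = 1 = [K_w : K⁺_v]` when `θ` is a `v`-adic square. -/
theorem ramificationIdx_mul_inertiaDeg_eq_finrank_of_isSquare
    (hsq : IsSquare (algebraMap (maximalRealSubfield K) (v.adicCompletion (maximalRealSubfield K)) θ)) :
    w.asIdeal.ramificationIdx (𝓞 (maximalRealSubfield K)) * w.asIdeal.inertiaDeg (𝓞 (maximalRealSubfield K)) =
      finrank (v.adicCompletion (maximalRealSubfield K)) (w.adicCompletion K) := by
  rw [ramificationIdx_eq_one_of_isSquare K v w hθ hy hsq, inertiaDeg_eq_one_of_isSquare K v w hθ hy hsq,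
    finrank_eq_one_of_isSquare K hθ hy v w hsq]

end Summit.Ventures.HodgeRepro2.T5FinitePlaceLocalDegree
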